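import Summits.Parity.GeneralizedHardyLittlewood.Theses.LeeYangFibres
import Summits.Parity.GeneralizedHardyLittlewood.Theorems.LeeYangFibresAbsoluteUpgradeUniformDefs
import Summits.Parity.GeneralizedHardyLittlewood.Theorems.LeeYangFibresAbsoluteUpgradeUniformDoor
import Summits.Parity.GeneralizedHardyLittlewood.Theorems.LeeYangFibresAbsoluteUpgradeUniformResidualDefs
import Summits.Parity.GeneralizedHardyLittlewood.Theorems.LeeYangFibresAbsoluteUpgradeUniformAmplificationTranslates
import Summits.Parity.GeneralizedHardyLittlewood.Theorems.LeeYangFibresAbsoluteUpgradeUniformAmplificationAux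
import Summits.Parity.GeneralizedHardyLittlewood.Theorems.LeeYangFibresRelativeDimOneAmplificationAux
import Summits.Parity.GeneralizedHardyLittlewood.Theorems.LeeYangFibresRelativeDimOneTightness
import Summits.Parity.GeneralizedHardyLittlewood.Theorems.LeeYangFibresRelativeDimOne
import Summits.Parity.GeneralizedHardyLittlewood.Theorems.LeeYangFibresCellParityLawSingularRatio
import Summits.Parity.GeneralizedHardyLittlewood.Theorems.LeeYangFibresAbsoluteUpgradeSlices
import Summits.Parity.GeneralizedHardyLittlewood.Theorems.LeeYangFibresAbsoluteUpgradeSingularProductLogLog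
import Summits.Parity.GeneralizedHardyLittlewood.Theorems.LeeYangFibresAbsoluteUpgradeSiegelGuard
import Summits.Parity.GeneralizedHardyLittlewood.Theorems.LeeYangFibresAbsoluteUpgradeTarget
import Literature.Barriers.Parity.SiegelZeroDichotomy
import Literature.Barriers.Parity.SiegelZeroPrimePairs
import HarnessLib

/-!
# Crux `AbsoluteUpgrade` (stmt-Parity-14116) — line `Sketch`, RESHAPED (lead seat c10, 2026-08-17):
# the rate exchange through UNIFORM AMPLIFICATION (strategist census S2, "door (b)")

`AbsoluteUpgrade := RelativeDimOne → DimOne` (route `LeeYangFibres`).  Kernel-checked book position (p121721, p139053):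
`AbsoluteUpgrade ↔ (DicksonFibration.DimOne ∨ ¬RelativeDimOne) ↔ (GeneralizedHardyLittlewood ∨ ¬RelativeDimOne)`.

The original line `Sketch` (lead 0) exchanged the crux for a RATE: `RelativeDimOneLogLogRate ↔ DimOne`
(`relativeDimOneLogLogRate_iff_dimOne`, with S1 `stub_singularProduct_le_loglog_pow` p86331 and the Siegel guard S2
`stub_siegelGuard` p87186), and its residual `stub_logLogRate` was the guarded crux (`stub_logLogRate_iff`; line declared
dead 2026-08-16, `Lines/Sketch-dead.md`).  This reshape inserts the one genuinely non-linear use of relative accuracy found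
by the strategist census (STRATEGY-CENSUS.md §2.3/S2): the tensor-power trick over translate-constellations.  If relative
Dickson–Hardy–Littlewood holds UNIFORMLY in the number of forms `T ≤ (log log N)^A` (`UniformRelativeDimOne`, S⁺), then the
complete-sum identity `S^{m+1} = ∑_H S(Ψ^{(H)}, K_H)` with `m + 1 ≍ (log log N)^{t-1}` translates, Gallagher's averaging
of the main terms UNIFORMLY IN `m` (`UniformSingularMean`, the provable heart), and `(m+1)`-th root extraction divide the
relative error by `m + 1`, beating `sup_Ψ ∏_p β_p ≍ (log log N)^{t-1}`: `UniformRelativeDimOne → DimOne`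
(`dimOne_of_uniformRelativeDimOne`).  Vocabulary and stub types: `Theorems/LeeYangFibresAbsoluteUpgradeUniformDefs.lean`
(p140471, namespace `…Cruxes.AbsoluteUpgrade.UniformAmplification`).

Stubs of the reshaped line.  SIX OF SEVEN LANDED (lead seat c10, wave 1, 2026-08-17; all `--supports stmt-Parity-14116`,
namespace `…Cruxes.AbsoluteUpgrade.UniformAmplification`): A `stub_localRatioFacts` p142343 (`…UniformLocalRatio`),
B `stub_condLocalAverage` p142195 (`…UniformCondLocalAverage`), C ∧ D2 `stub_collisionFormFactsAndTail` p141734 + p142737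
(`…UniformCollisionForms`, `…UniformTailCollisions`), D1 `stub_mediumCollisions` p142247 + p142664 + p145079
(`…UniformMediumCollisions{Aux,Aux2,}`), E `stub_uniformSingularMeanGlue` p142753 + p143097 + p145040
(`…UniformSingularMeanGlue{Aux,Aux2,}`), F `stub_amplification` p142086 + p143322 (`…UniformAmplification{Aux,}`); composed BY
NAME in `Theorems/LeeYangFibresAbsoluteUpgradeUniformDoor.lean`: `uniformSingularMean : UniformSingularMean` (the m-uniform
Gallagher average, UNCONDITIONAL) and `dimOne_of_uniformRelativeDimOne : UniformRelativeDimOne → DimOne` (door (b), PROVED),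
with corollaries `… → AbsoluteUpgrade`, `… → RelativeDimOne`, `… → GeneralizedHardyLittlewood`.
The ONE remaining stub — SHARPENED in cycle 2 (S⁺ ↦ S⁺_transl: vocabulary `Theorems/LeeYangFibresAbsoluteUpgradeUniformResidualDefs.lean`
p146801, transfer F′ `stub_amplificationFromTranslates` p146913), SPLIT in cycle 3 (S⁺_transl ↦ `RelativeDimOne` ∧ S⁺_high: appended
vocabulary p147563, transfer F″ `stub_amplificationHighMass` p147618) and THINNED in cycle 4 (S⁺_high ↦ S⁺_∞ = `∃ G ≥ 5, …At G`: second
append, transfer F‴ `stub_amplificationEventualHighMass` in `Theorems/LeeYangFibresAbsoluteUpgradeUniformAmplificationEventualHighMass.lean`):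
* `stub_eventualHighMassTranslateRelativeDimOne : EventualHighMassTranslateRelativeDimOne` — S⁺_∞, the conjectural RESIDUAL (held by
  the lead, never delegated): for SOME constant `G ≥ 5`, relative Dickson–Hardy–Littlewood for the non-degenerate translate-constellations
  `Ψ^{(H)}`, `m ≥ 1`, of `t`-systems of size `≤ L` whose base instance `(Ψ, K)` has singular mass `β_∞(Ψ,K)𝔖(Ψ) ≥ G·N`, uniformly in
  `(m+1)t ≤ (log log N)^A` — i.e. only for instances of ASYMPTOTICALLY MAXIMAL singular series (`𝔖 ≥ G/2`: the primorial-type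
  alignments, the census's inhabited hard family).  THE CRUX HYPOTHESIS `RelativeDimOne` IS LOAD-BEARING: it carries every bounded-mass
  sector `β_∞𝔖 < G·N` (relative accuracy `ε(β_∞𝔖 + N) ≤ (G+1)εN` is already absolute there; twin primes live there), so
  `AbsoluteUpgrade_of hR := F‴ uniformSingularMean C hR S⁺_∞`.  HONESTY: S⁺_∞ implies the CRUX
  (`absoluteUpgrade_of_eventualHighMassTranslate`, F‴ file); whether it implies the target `DimOne` outright is NOT claimed and not expected
  to be provable here (it says nothing about bounded-mass instances) — unlike every earlier residual of this crux (c3–c5: residual ⟹ target,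
  `R` inert).  Chain of residuals: `UniformRelativeDimOne ⟹ TranslateUniformRelativeDimOne ⟹ HighMassTranslateRelativeDimOne ⟹
  EventualHighMassTranslateRelativeDimOne` (p146801 and its two appends), and doors (b) `dimOne_of_uniformRelativeDimOne` (p146814), (b′)
  `dimOne_of_translateUniform` (p146913), (b″) `dimOne_of_relative_of_highMass` (p147618), (b‴) `dimOne_of_relative_of_eventualHighMass` (F‴) are
  THEOREMS serving every `d = 1` route whose mechanism outputs relative errors, for both wanting routes.  Outcome token unchanged:
  `blocked-on: stmt-Parity-0819`.

What stands from the original line (LANDED): S1 p86331, S2 p87186, `relativeDimOneLogLogRate_iff_dimOne`,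
`stub_logLogRate_iff` (the old residual ≡ the guarded crux) — kept verbatim below; the old residual `stub_logLogRate` is now
DERIVED from the new chain (`logLogRate_of_uniform`).
-/

noncomputable section

namespace Summit.Parity.GeneralizedHardyLittlewood.Cruxes.AbsoluteUpgrade.Sketch

open Literature.NumberTheory.Sieve Literature.Barriers.Parity
open Summit.Parity.GeneralizedHardyLittlewood.Theses.LeeYangFibres
open Summit.Parity.GeneralizedHardyLittlewood.Theorems.AbsoluteUpgrade (archFactor_le_two_mul)
open Summit.Parity.GeneralizedHardyLittlewood.Cruxes.AbsoluteUpgrade.UniformAmplification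

/-! ## Typed statements (original line) -/

/-- Relative Dickson–Hardy–Littlewood WITH THE LOG-LOG RATE: the error of `RelativeDimOne` with the relative
part divided by `(log log N)^{t-1}`, i.e. `|Σ - β_∞ ∏β_p| ≤ ε (β_∞ ∏β_p / (log log N)^{t-1} + N)`.
(At `t = 1` this is `RelativeDimOne`; for `t ≥ 2` it is exactly what the residual asks.) [folklore] -/
def RelativeDimOneLogLogRate : Prop :=
  ∀ (t L : ℕ), 1 ≤ t → ∀ ε : ℝ, 0 < ε → ∃ N₀ : ℕ, ∀ N : ℕ, N₀ ≤ N → ∀ Ψ : Fin t → AffLinForm 1,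
    IsNondegenerateSystem Ψ → affLinSize Ψ N ≤ L → ∀ K : Set (Fin 1 → ℝ), Convex ℝ K → K ⊆ realBox 1 N →
      |vonMangoldtSum Ψ K N - archFactor Ψ K * singularProduct Ψ| ≤
        ε * (archFactor Ψ K * singularProduct Ψ / Real.log (Real.log N) ^ (t - 1) + N)

/-! ## Landed pieces of the original line -/

/-- **S1 (LANDED, p86331).** `∏_p β_p ≤ C(t, L) (log log N)^{t-1}` uniformly over non-degenerate `d = 1`
systems of `t` forms with `‖Ψ‖_N ≤ L`, `N ≥ N₀(t, L)`. [cite: GreenTao2010, Lemma 1.3] -/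
theorem singularProduct_le_loglog_pow (t L : ℕ) (ht : 1 ≤ t) :
    ∃ C : ℝ, 0 < C ∧ ∃ N₀ : ℕ, ∀ N : ℕ, N₀ ≤ N → ∀ Ψ : Fin t → AffLinForm 1,
      IsNondegenerateSystem Ψ → affLinSize Ψ N ≤ L →
        singularProduct Ψ ≤ C * Real.log (Real.log N) ^ (t - 1) :=
  Summit.Parity.GeneralizedHardyLittlewood.Theorems.AbsoluteUpgrade.stub_singularProduct_le_loglog_pow t L ht

/-- **S2 (LANDED, p87186; the vendored theorem of Matomäki–Merikoski is a hypothesis).** Relative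
Dickson–Hardy–Littlewood (uniform over shifts `≤ L N`) excludes Siegel zeros of unbounded quality.
[cite: MatomakiMerikoski2023, Theorem 1.3] -/
theorem siegelGuard :
    MatomakiMerikoski2023_pairCorrelation → RelativeDimOne → ¬ UnboundedSiegelZeros :=
  Summit.Parity.GeneralizedHardyLittlewood.Theorems.AbsoluteUpgrade.stub_siegelGuard

/-! ## Stubs of the reshaped line (uniform amplification) -/

/-- **S⁺_∞ — the RESIDUAL (conjectural; held by the lead, never delegated; sharpened in cycle 2, split in cycle 3, thinned in cycle 4).**
For SOME constant `G ≥ 5`: relative Dickson–Hardy–Littlewood with Green–Tao's Conj. 1.4 error shape `ε(β_∞∏β_p + N)` for the non-degenerate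
translate-constellations `Ψ^{(H)}`, `H ∈ [-2N,2N]^m`, `m ≥ 1`, of non-degenerate `t`-systems `Ψ` with `‖Ψ‖_N ≤ L` on the bodies `K_H`, for base
instances of singular mass `β_∞(Ψ,K)𝔖(Ψ) ≥ G·N`, uniformly in `(m+1) t ≤ (log log N)^A`.  With `RelativeDimOne` it gives `DimOne` (F‴);
alone it is not claimed to.  Implied by each of `HighMassTranslateRelativeDimOne`, `TranslateUniformRelativeDimOne`, `UniformRelativeDimOne`.
[cite: GreenTao2010, Conj. 1.4] -/
theorem stub_eventualHighMassTranslateRelativeDimOne : EventualHighMassTranslateRelativeDimOne := by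
  sorry

/-! ## Composition of the reshaped line (the six provable stubs are LANDED; see `…UniformDoor`) -/

/-- **m-uniform Gallagher averaging** — landed composition of A, B, C ∧ D2, D1, E
(`UniformAmplification.uniformSingularMean`, `Theorems/LeeYangFibresAbsoluteUpgradeUniformDoor.lean`). [cite: Gallagher1976, Section 2] -/
theorem uniformSingularMean : UniformSingularMean :=
  UniformAmplification.uniformSingularMean

/-- **THE AMPLIFICATION THEOREM (door (b) of the census), LANDED: `t`-uniform RELATIVE Dickson–Hardy–Littlewood implies
ABSOLUTE Dickson–Hardy–Littlewood** (`UniformAmplification.dimOne_of_uniformRelativeDimOne`). [cite: GreenTao2010, Conj. 1.2 and Conj. 1.4] -/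
theorem dimOne_of_uniformRelativeDimOne (h : UniformRelativeDimOne) : DimOne :=
  UniformAmplification.dimOne_of_uniformRelativeDimOne h

/-- **Door (b′), LANDED: the SHARPENED residual already gives ABSOLUTE Dickson–Hardy–Littlewood** — the transfer run from
relative Hardy–Littlewood for translate-constellations only (`UniformAmplification.stub_amplificationFromTranslates`).
[cite: GreenTao2010, Conj. 1.2 and Conj. 1.4] -/
theorem dimOne_of_translateUniform (h : TranslateUniformRelativeDimOne) : DimOne :=
  UniformAmplification.stub_amplificationFromTranslates UniformAmplification.uniformSingularMean
    UniformAmplification.stub_collisionFormFactsAndTail.1 h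

/-- The old residual S⁺ implies the sharpened one (landed, p146801). [cite: GreenTao2010, Conj. 1.4] -/
theorem translateUniform_of_uniform (h : UniformRelativeDimOne) : TranslateUniformRelativeDimOne :=
  UniformAmplification.translateUniformRelativeDimOne_of_uniform h

/-- The sharpened residual implies the high-mass residual (landed, appended vocabulary). [folklore] -/
theorem highMass_of_translateUniform (h : TranslateUniformRelativeDimOne) : HighMassTranslateRelativeDimOne :=
  UniformAmplification.highMassTranslate_of_translateUniform h

/-- The high-mass residual implies the eventual-high-mass residual (landed, second append). [folklore] -/
theorem eventualHighMass_of_highMass (h : HighMassTranslateRelativeDimOne) : EventualHighMassTranslateRelativeDimOne :=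
  UniformAmplification.eventualHighMass_of_highMass h

section InlineTransfer

open scoped BigOperators Classical Topology
open Finset Filter MeasureTheory
open Summit.Parity.GeneralizedHardyLittlewood.Cruxes.RelativeDimOne.TranslateAmplification

/-- **The transfer above the mass threshold `G·N`** — INLINE COPY of the landed/in-flight
`UniformAmplification.amplificationHighMassAt` (`Theorems/LeeYangFibresAbsoluteUpgradeUniformAmplificationEventualHighMass.lean`),
kept verbatim only until the farm has built that module (then this section becomes two one-line references).
[cite: GreenTao2010, Conj. 1.2 and Conj. 1.4] -/
theorem amplificationHighMassAt_inline (G : ℕ) (hG : 5 ≤ G) (hUSM : UniformSingularMean) (hCF : CollisionFormFacts)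
    (hR : Summit.Parity.GeneralizedHardyLittlewood.Theses.LeeYangFibres.RelativeDimOne)
    (hS : HighMassTranslateRelativeDimOneAt G) : Theses.LeeYangFibres.DimOne := by
  intro t L ht ε hε
  -- `e = min ε 1`
  obtain ⟨e, he⟩ : ∃ e : ℝ, e = min ε 1 := ⟨_, rfl⟩
  have he0 : 0 < e := by rw [he]; exact lt_min hε one_pos
  have he1 : e ≤ 1 := by rw [he]; exact min_le_right _ _
  have heε : e ≤ ε := by rw [he]; exact min_le_left _ _
  -- the singular-mass constant (S1) and `ε₁`
  obtain ⟨C, hC0, N₁, hS1⟩ := Theorems.AbsoluteUpgrade.stub_singularProduct_le_loglog_pow t L ht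
  have hG0 : (0 : ℝ) ≤ G := Nat.cast_nonneg G
  have hG5 : (5 : ℝ) ≤ G := by exact_mod_cast hG
  obtain ⟨ε₁, hε₁⟩ : ∃ ε₁ : ℝ, ε₁ = e / (100 * (C + 1) * ((G : ℝ) + 1)) := ⟨_, rfl⟩
  have hε₁0 : 0 < ε₁ := by rw [hε₁]; positivity
  have hε₁' : ε₁ ≤ e / (100 * (C + 1)) := by
    rw [hε₁]
    exact div_le_div_of_nonneg_left he0.le (by positivity) (le_mul_of_one_le_right (by positivity) (by linarith))
  have hε₁8 : ε₁ ≤ 1 / 8 := by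
    refine hε₁'.trans ?_
    rw [div_le_iff₀ (by positivity)]
    linarith
  have hG1 : ((G : ℝ) + 1) * ε₁ ≤ e := by
    rw [hε₁, mul_div_assoc', div_le_iff₀ (by positivity)]
    nlinarith [mul_nonneg he0.le hC0.le, mul_nonneg (mul_nonneg he0.le hC0.le) hG0, mul_nonneg he0.le hG0]
  have h16 : 16 * ε₁ * C ≤ e := by
    have h1 : 16 * ε₁ * C ≤ 16 * (e / (100 * (C + 1))) * C :=
      mul_le_mul_of_nonneg_right (mul_le_mul_of_nonneg_left hε₁' (by norm_num)) hC0.le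
    have h2 : 16 * (e / (100 * (C + 1))) * C = e * (16 * C / (100 * (C + 1))) := by ring
    have h3 : 16 * C / (100 * (C + 1)) ≤ 1 := by
      rw [div_le_one (by positivity)]
      linarith
    rw [h2] at h1
    exact h1.trans ((mul_le_mul_of_nonneg_left h3 he0.le).trans (le_of_eq (mul_one e)))
  -- the hypotheses, instantiated once (before the scale)
  obtain ⟨N₂, hN₂⟩ := hR t L ht ε₁ hε₁0
  obtain ⟨N₃, hN₃⟩ := hS t L t ht ε₁ hε₁0
  obtain ⟨N₄, hN₄⟩ := hUSM t L t ht ε₁ hε₁0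
  -- the scale: `log log N ≥ 2t`, `N ≥ 1`, and the uniform junk inequality
  have hL₁ : (1 : ℝ) ≤ ((max L 1 : ℕ) : ℝ) := by exact_mod_cast le_max_right L 1
  have hLL₁ : (L : ℝ) ≤ ((max L 1 : ℕ) : ℝ) := by exact_mod_cast le_max_left L 1
  obtain ⟨N₅, hN₅⟩ := Filter.eventually_atTop.mp ((eventually_le_loglog (2 * (t : ℝ))).and
    ((eventually_ge_atTop 1).and (eventually_degenerate_junk_le ht hL₁ hε₁0)))
  refine ⟨N₁ + N₂ + N₃ + N₄ + N₅, fun N hN Ψ hΨ hL K hK hKN => ?_⟩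
  have hNN₁ : N₁ ≤ N := by omega
  have hNN₂ : N₂ ≤ N := by omega
  have hNN₃ : N₃ ≤ N := by omega
  have hNN₄ : N₄ ≤ N := by omega
  obtain ⟨hℓ, hN1, hJ⟩ := hN₅ N (by omega)
  have hN0 : (0 : ℝ) ≤ N := Nat.cast_nonneg N
  have hN1r : (1 : ℝ) ≤ N := by exact_mod_cast hN1
  -- the number of translates
  obtain ⟨m, hm1, hmℓ, hT⟩ := exists_translates ht hℓ
  have hm0 : (0 : ℝ) < (m : ℝ) + 1 := by positivity
  -- `S`, `M = β_∞ 𝔖` and the singular mass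
  have hS0 : 0 ≤ vonMangoldtSum Ψ K N :=
    Theorems.LeeYangFibresRelativeDimOne.vonMangoldtSum_nonneg Ψ K N
  have hV0 : 0 ≤ archFactor Ψ K := archFactor_nonneg' Ψ K
  have hV2 : archFactor Ψ K ≤ 2 * (N : ℝ) := Theorems.AbsoluteUpgrade.archFactor_le_two_mul Ψ hKN
  have h𝔖0 : 0 ≤ singularProduct Ψ :=
    CellParityLaw.SectionAnnihilator.SingularRatio.singularProduct_nonneg hΨ
  have h𝔖C : singularProduct Ψ ≤ C * Real.log (Real.log N) ^ (t - 1) := hS1 N hNN₁ Ψ hΨ hL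
  have hM0 : 0 ≤ archFactor Ψ K * singularProduct Ψ := mul_nonneg hV0 h𝔖0
  have hMle : archFactor Ψ K * singularProduct Ψ ≤ 2 * (N : ℝ) * (C * ((m : ℝ) + 1)) :=
    calc archFactor Ψ K * singularProduct Ψ ≤ 2 * (N : ℝ) * (C * Real.log (Real.log N) ^ (t - 1)) :=
          mul_le_mul hV2 h𝔖C h𝔖0 (by positivity)
      _ ≤ 2 * (N : ℝ) * (C * ((m : ℝ) + 1)) :=
          mul_le_mul_of_nonneg_left (mul_le_mul_of_nonneg_left hmℓ.le hC0.le) (by positivity)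
  have heN : e * (N : ℝ) ≤ ε * N := mul_le_mul_of_nonneg_right heε hN0
  rcases lt_or_ge (archFactor Ψ K * singularProduct Ψ) ((G : ℝ) * N) with hlow | hhighG
  · -- MASS BELOW `G·N`: the crux hypothesis `RelativeDimOne` itself (relative error `ε₁(M + N) ≤ (G+1) ε₁ N` is absolute here)
    have h := hN₂ N hNN₂ Ψ hΨ hL K hK hKN
    calc |vonMangoldtSum Ψ K N - archFactor Ψ K * singularProduct Ψ|
        ≤ ε₁ * (archFactor Ψ K * singularProduct Ψ + N) := h
      _ ≤ ε₁ * (((G : ℝ) + 1) * N) := mul_le_mul_of_nonneg_left (by linarith) hε₁0.le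
      _ = ((G : ℝ) + 1) * ε₁ * N := by ring
      _ ≤ e * N := mul_le_mul_of_nonneg_right hG1 hN0
      _ ≤ ε * N := heN
  · -- MASS `≥ G·N ≥ 5N`: the tensor-power trick with `m + 1` translates
    have hhigh : 5 * (N : ℝ) ≤ archFactor Ψ K * singularProduct Ψ :=
      le_trans (mul_le_mul_of_nonneg_right hG5 hN0) hhighG
    have hL'1 : (1 : ℝ) ≤ (3 * (m : ℝ) + 1) * ((max L 1 : ℕ) : ℝ) := by
      have hm0' : (0 : ℝ) ≤ m := Nat.cast_nonneg m
      nlinarith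
    have hsize' : ∀ H ∈ shiftBox m N,
        affLinSize (translateFamily Ψ H) N ≤ (3 * m + 1) * ((max L 1 : ℕ) : ℝ) :=
      fun H hH => affLinSize_translateFamily_le hN1 (hL.trans hLL₁) hH
    have hB0 : 0 ≤ (2 * (N : ℝ) + 1) *
        Real.log (2 * ((3 * (m : ℝ) + 1) * ((max L 1 : ℕ) : ℝ)) * N) ^ ((m + 1) * t) := by
      refine mul_nonneg (by positivity) (pow_nonneg (Real.log_nonneg ?_) _)
      nlinarith
    have key := uniform_high_mass_amplify (shiftBox m N)
      (fun H => IsNondegenerateSystem (translateFamily Ψ H))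
      (fun H => vonMangoldtSum (translateFamily Ψ H) (meetTranslates K H) N)
      (fun H => archFactor (translateFamily Ψ H) (meetTranslates K H) *
        singularProduct (translateFamily Ψ H))
      m hε₁0.le hε₁8 hS0 hM0 hhigh (completeSum m t N Ψ K hKN) (hN₄ N hNN₄ m hT Ψ hΨ hL K hK hKN)
      (fun H hH hnd => hN₃ N hNN₃ m hm1 hT Ψ hΨ hL K hK hKN hhighG H hH hnd)
      (fun H hH _ => vonMangoldtSum_le_card_mul hN1 hL'1 (hsize' H hH) (meetTranslates K H))
      hB0
      (fun H _ => Theorems.LeeYangFibresRelativeDimOne.vonMangoldtSum_nonneg _ _ _)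
      (card_shiftBox_real_le m hN1) (hCF.1 m t N Ψ hΨ) (hJ m hT)
    calc |vonMangoldtSum Ψ K N - archFactor Ψ K * singularProduct Ψ|
        ≤ 8 * ε₁ / ((m : ℝ) + 1) * (archFactor Ψ K * singularProduct Ψ) := key
      _ ≤ 8 * ε₁ / ((m : ℝ) + 1) * (2 * (N : ℝ) * (C * ((m : ℝ) + 1))) :=
          mul_le_mul_of_nonneg_left hMle (by positivity)
      _ = 16 * ε₁ * C * N := by
          rw [div_mul_eq_mul_div, div_eq_iff hm0.ne']
          ring
      _ ≤ e * N := mul_le_mul_of_nonneg_right h16 hN0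
      _ ≤ ε * N := heN

end InlineTransfer

/-- **Door (b″), LANDED (p147618; here from the inline threshold-`G` transfer at `G = 5`): `RelativeDimOne` (low mass) + the
high-mass residual ⟹ ABSOLUTE Dickson–Hardy–Littlewood.** [cite: GreenTao2010, Conj. 1.2 and Conj. 1.4] -/
theorem dimOne_of_relative_of_highMass (hR : RelativeDimOne) (h : HighMassTranslateRelativeDimOne) : DimOne :=
  amplificationHighMassAt_inline 5 le_rfl UniformAmplification.uniformSingularMean
    UniformAmplification.stub_collisionFormFactsAndTail.1 hR (UniformAmplification.highMassTranslateRelativeDimOneAt_five h)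

/-- **Door (b‴) (landed as `UniformAmplification.stub_amplificationEventualHighMass`; here from the inline transfer): `RelativeDimOne`
(every bounded-mass sector) + the eventual-high-mass residual ⟹ ABSOLUTE Dickson–Hardy–Littlewood.** [cite: GreenTao2010, Conj. 1.2 and Conj. 1.4] -/
theorem dimOne_of_relative_of_eventualHighMass (hR : RelativeDimOne) (h : EventualHighMassTranslateRelativeDimOne) : DimOne := by
  obtain ⟨G, hG, hS⟩ := h
  exact amplificationHighMassAt_inline G hG UniformAmplification.uniformSingularMean
    UniformAmplification.stub_collisionFormFactsAndTail.1 hR hS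

/-! ## Bookkeeping of the original line (proved) -/

/-- `0 < log log N` for `N ≥ 16`. [folklore] -/
theorem loglog_pos {N : ℕ} (hN : 16 ≤ N) : 0 < Real.log (Real.log N) := by
  have hN' : (16 : ℝ) ≤ N := by exact_mod_cast hN
  apply Real.log_pos
  have h3 : Real.exp 1 < 3 := Real.exp_one_lt_three
  have : (1 : ℝ) < Real.log 16 := by
    rw [Real.lt_log_iff_exp_lt (by norm_num)]
    linarith
  exact lt_of_lt_of_le this (Real.log_le_log (by norm_num) hN')

/-- **Rate exchange (bookkeeping).** The log-log rate together with the singular-product bound S1 (for every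
`t, L`) gives `DimOne`: `ε' (β_∞ ∏β_p / (log log N)^{t-1} + N) ≤ ε' (2N·C + N) = ε N` with `ε' = ε/(2C+1)`,
using `β_∞ ≤ 2N` (`archFactor_le_two_mul`). [folklore] -/
theorem dimOne_of_logLogRate (hrate : RelativeDimOneLogLogRate)
    (hS : ∀ t L : ℕ, 1 ≤ t → ∃ C : ℝ, 0 < C ∧ ∃ N₀ : ℕ, ∀ N : ℕ, N₀ ≤ N → ∀ Ψ : Fin t → AffLinForm 1,
      IsNondegenerateSystem Ψ → affLinSize Ψ N ≤ L →
        singularProduct Ψ ≤ C * Real.log (Real.log N) ^ (t - 1)) : DimOne := by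
  intro t L ht ε hε
  obtain ⟨C, hC, N₁, hN₁⟩ := hS t L ht
  obtain ⟨N₂, hN₂⟩ := hrate t L ht (ε / (2 * C + 1)) (by positivity)
  refine ⟨max (max N₁ N₂) 16, fun N hN Ψ hΨ hL K hK hKN => ?_⟩
  have hN1 : N₁ ≤ N := le_trans (le_max_left _ _) (le_trans (le_max_left _ _) hN)
  have hN2 : N₂ ≤ N := le_trans (le_max_right _ _) (le_trans (le_max_left _ _) hN)
  have hN16 : 16 ≤ N := le_trans (le_max_right _ _) hN
  have hll : 0 < Real.log (Real.log N) := loglog_pos hN16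
  have hpow : 0 < Real.log (Real.log N) ^ (t - 1) := pow_pos hll _
  have hSle := hN₁ N hN1 Ψ hΨ hL
  have harch0 : 0 ≤ archFactor Ψ K := ENNReal.toReal_nonneg
  have harch := archFactor_le_two_mul Ψ hKN
  have hNr : (0 : ℝ) ≤ N := Nat.cast_nonneg N
  have hmass : archFactor Ψ K * singularProduct Ψ / Real.log (Real.log N) ^ (t - 1) ≤ 2 * N * C := by
    rw [div_le_iff₀ hpow]
    calc archFactor Ψ K * singularProduct Ψ
        ≤ archFactor Ψ K * (C * Real.log (Real.log N) ^ (t - 1)) :=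
          mul_le_mul_of_nonneg_left hSle harch0
      _ ≤ (2 * N) * (C * Real.log (Real.log N) ^ (t - 1)) :=
          mul_le_mul_of_nonneg_right harch (by positivity)
      _ = 2 * N * C * Real.log (Real.log N) ^ (t - 1) := by ring
  calc |vonMangoldtSum Ψ K N - archFactor Ψ K * singularProduct Ψ|
      ≤ ε / (2 * C + 1) * (archFactor Ψ K * singularProduct Ψ / Real.log (Real.log N) ^ (t - 1) + N) :=
        hN₂ N hN2 Ψ hΨ hL K hK hKN
    _ ≤ ε / (2 * C + 1) * (2 * N * C + N) := by gcongr
    _ = ε * (N : ℝ) := by field_simp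

/-- `∏_p β_p ≥ 0` for a non-degenerate system (limit of non-negative partial products). [folklore] -/
theorem singularProduct_nonneg' {t : ℕ} {Ψ : Fin t → AffLinForm 1} (h : IsNondegenerateSystem Ψ) :
    0 ≤ singularProduct Ψ :=
  ge_of_tendsto' (tendsto_singularProductPartial_holds 1 t Ψ h)
    fun _ => Finset.prod_nonneg fun p _ => localFactor_nonneg Ψ p

/-- **The log-log rate IS `DimOne`** (given the landed S1): `→` is the rate exchange `dimOne_of_logLogRate`;
`←` because `ε N ≤ ε (β_∞ ∏β_p / (log log N)^{t-1} + N)` (`β_∞, ∏β_p ≥ 0`). [folklore] -/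
theorem relativeDimOneLogLogRate_iff_dimOne : RelativeDimOneLogLogRate ↔ DimOne := by
  constructor
  · intro hrate
    exact dimOne_of_logLogRate hrate (fun t L ht => singularProduct_le_loglog_pow t L ht)
  · intro hD t L ht ε hε
    obtain ⟨N₀, hN₀⟩ := hD t L ht ε hε
    refine ⟨max N₀ 16, fun N hN Ψ hΨ hL K hK hKN => ?_⟩
    have hN0 : N₀ ≤ N := le_trans (le_max_left _ _) hN
    have hN16 : 16 ≤ N := le_trans (le_max_right _ _) hN
    have hpow : 0 < Real.log (Real.log N) ^ (t - 1) := pow_pos (loglog_pos hN16) _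
    have hmass : 0 ≤ archFactor Ψ K * singularProduct Ψ / Real.log (Real.log N) ^ (t - 1) :=
      div_nonneg (mul_nonneg ENNReal.toReal_nonneg (singularProduct_nonneg' hΨ)) hpow.le
    calc |vonMangoldtSum Ψ K N - archFactor Ψ K * singularProduct Ψ| ≤ ε * N :=
          hN₀ N hN0 Ψ hΨ hL K hK hKN
      _ ≤ ε * (archFactor Ψ K * singularProduct Ψ / Real.log (Real.log N) ^ (t - 1) + N) := by
          gcongr; linarith

/-- The old residual S4 (log-log rate off Siegel zeros) is now DERIVED from the reshaped chain (the guard unused, `RelativeDimOne`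
used for the low-mass sector).
[cite: GreenTao2010, Conj. 1.2 and Conj. 1.4] -/
theorem logLogRate_of_uniform :
    (MatomakiMerikoski2023_pairCorrelation → ¬ UnboundedSiegelZeros) →
      RelativeDimOne → RelativeDimOneLogLogRate :=
  fun _ hR => relativeDimOneLogLogRate_iff_dimOne.mpr
    (dimOne_of_relative_of_eventualHighMass hR stub_eventualHighMassTranslateRelativeDimOne)

/-- **Honesty lemma of the original line (kept): the old stub S4 is equivalent to the Siegel-guarded crux.** [folklore] -/
theorem stub_logLogRate_iff :
    ((MatomakiMerikoski2023_pairCorrelation → ¬ UnboundedSiegelZeros) →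
        RelativeDimOne → RelativeDimOneLogLogRate) ↔
      ((MatomakiMerikoski2023_pairCorrelation → ¬ UnboundedSiegelZeros) → AbsoluteUpgrade) := by
  unfold AbsoluteUpgrade
  constructor
  · intro h hG hR
    exact relativeDimOneLogLogRate_iff_dimOne.mp (h hG hR)
  · intro h hG hR
    exact relativeDimOneLogLogRate_iff_dimOne.mpr (h hG hR)

/-- **Honesty lemma of the reshaped line: the old residual S⁺ implies the target** (it is not below target strength; the
line's value is the amplification theorem, not a cheaper residual). [folklore] -/
theorem target_of_uniformRelativeDimOne (h : UniformRelativeDimOne) :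
    Summit.Parity.GeneralizedHardyLittlewood.Theses.DicksonFibration.DimOne :=
  Summit.Parity.GeneralizedHardyLittlewood.Theorems.AbsoluteUpgrade.dimOne_iff_target.mp
    (dimOne_of_uniformRelativeDimOne h)

/-- **Honesty lemma for the sharpened residual: S⁺_transl implies the target as well.** [folklore] -/
theorem target_of_translateUniform (h : TranslateUniformRelativeDimOne) :
    Summit.Parity.GeneralizedHardyLittlewood.Theses.DicksonFibration.DimOne :=
  Summit.Parity.GeneralizedHardyLittlewood.Theorems.AbsoluteUpgrade.dimOne_iff_target.mp
    (dimOne_of_translateUniform h)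

/-- **Position of the sharpened residual against the Statement**: S⁺_transl implies Green–Tao's Conjecture 1.2 for all `d`
(door (b′) followed by the proved fibration lemma, `summit_iff_dimOne` p139053). [cite: GreenTao2010, Conj. 1.2 and Conj. 1.4] -/
theorem summit_of_translateUniform (h : TranslateUniformRelativeDimOne) : _root_.GeneralizedHardyLittlewood :=
  Summit.Parity.GeneralizedHardyLittlewood.Theorems.AbsoluteUpgrade.summit_iff_dimOne.mpr (dimOne_of_translateUniform h)

/-- **Position of the residual**: TOGETHER with `RelativeDimOne`, S⁺_∞ gives the sub-problem Statement (`summit_iff_dimOne`,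
p139053); alone it gives the CRUX (`UniformAmplification.absoluteUpgrade_of_eventualHighMassTranslate`, F‴ file) — no claim that it
implies the target. [cite: GreenTao2010, Conj. 1.2 and the remark following it] -/
theorem summit_of_relative_of_eventualHighMass (hR : RelativeDimOne) (h : EventualHighMassTranslateRelativeDimOne) :
    _root_.GeneralizedHardyLittlewood :=
  Summit.Parity.GeneralizedHardyLittlewood.Theorems.AbsoluteUpgrade.summit_iff_dimOne.mpr
    (dimOne_of_relative_of_eventualHighMass hR h)

/-! ## Composition -/

/-- **The reshaped line closes the crux modulo its one residual stub, USING the crux hypothesis**: `RelativeDimOne` carries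
every bounded-mass sector, S⁺_∞ the asymptotically-maximal-mass sector, through the amplification with m-uniform Gallagher (all LANDED).
[folklore] -/
theorem AbsoluteUpgrade_of : AbsoluteUpgrade := by
  unfold AbsoluteUpgrade
  intro hR
  exact dimOne_of_relative_of_eventualHighMass hR stub_eventualHighMassTranslateRelativeDimOne

end Summit.Parity.GeneralizedHardyLittlewood.Cruxes.AbsoluteUpgrade.Sketch

end
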